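import Summits.QuantumFields.BalabanUV.Beta.D1BFx.PackedDressingBridge
import Summits.QuantumFields.BalabanUV.Beta.D1BFx.GhostStencil
import Summits.QuantumFields.BalabanUV.Beta.D1BFx.ReducedKernelF

/-!
# `BalabanUV.Beta.D1BFx.PackedGhostWordEnd` — road «BF-x» for binder row D1, slot (K): PART 9 «THE ROAD's SCALAR-WEIGHTED WORDS IN THE END's CURRENCY» —
# **a word packed with the columns of the road's GAUGED resolvent `G₀ := coDressKBmAt (toSite r) N (KInvStep N 0)` IS the END's `wH`-packed word
# (`ReducedKernelF.vertexRedF`) of the Πᵀ_bm-DRESSED family**: `Σ_κ wsum (colH G₀ N μ y κ) (F κ) = vertexRedF N (Πᵀ_bm F) μ y` (PACK-BRIDGE §4 + `KInvStep_zero_eq` +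
# `vertexOf_weight`), hence for the ghost tower of PART 7 (`PackedRoadHptwGhost`):
# `hessKer (Ggh N a) (κ′ v ↦ c • 𝒢[colH G₀ N κ′ v]) W = TOfGh N a (κ u ↦ c • (Πᵀ_bm ghCur) κ u) W` — the road's ghost MAIN WORD is the END's `TOfGh` (`GhostKernelComplete.PghQ`'s
# functional) at the DRESSED ghost currents.  This turns Q-GH-W′ ∕ PART 8's (J3) into a dictionary equation between TREE stencil families, exactly like (J2):
# the END's `SghAt ρ n cK cQ = cK•ghCur + cQ•qAntiAt ρ n` (UNDRESSED current + the `Q′*Q′` jet) versus `c • Πᵀ_bm ghCur`.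

HONEST DEPENDENCY (cell records, verbatim): «continuum YM on T⁴ ⇐ BetaPertH ∧ nine spine estimates (0/9 proved); BetaPertH ⇐ (D1) ∧ (D4) ∧
CAP+tail; G-an2-4 gates asym, D1 and NE2/3/4.»  HONEST FRAMING (cell contract, verbatim): «discharging `BetaPertH` makes Bałaban's UV stability
UNCONDITIONAL — a real constructive-QFT result; it is NOT the continuum limit and NOT the Clay problem.»  THIS MODULE DISCHARGES NOTHING of (K),
of D1 or of the wall: [folklore] `ℓ¹` bookkeeping BY NAME.  No definition, no `def … : Prop`, nothing cited, 0 sorry.  0 root-level binders of row D1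
discharged; (K) NOT closed; NOT D1, NOT `BetaPertH`, NOT continuum, NOT Clay.

ABSOLUTE RULE (cell charter, verbatim): «No internally-minted statement may enter as a cited fact. Every hypothesis is either kernel-proved in this
package or a verbatim quotation of a PUBLISHED theorem with page reference. The manuscript(s) under audit are NOT citable for their own disputed
steps — they are the thing under adjudication; programme-internal (2001/route/tribunal) claims are never citable.»

CONTENT (all [folklore]): `abs_ghCur_le_two`, `vertexRedF_const_smul`, **`sum_wsum_colH_G₀_eq_vertexRedF`**, **`ghostWord_G₀_eq_TOfGh_coProj`**.
Unit `b2b-balaban-beta-d1-p2` (road owner, gen 18), 2026-08-22.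
-/

noncomputable section

namespace Summit.QuantumFields.BalabanUV.Beta.D1BFx.PackedGhostWordEnd

open scoped BigOperators
open Literature.MathematicalPhysics.QuantumFieldTheory.Balaban1983to89
open Literature.MathematicalPhysics.QuantumFieldTheory.Balaban1983to89.Beta
open ExpKernelCalculus (MKer Decays hessKer)
open AffineAveraging (box toSite)
open OneStepResolventKernel (Fib wsum KInv vertexOf_weight)
open OneStepKernelFamily (KInvStep colH decays_KInvStep)
open KernelSpecInstance (wH)
open Summit.QuantumFields.BalabanUV.Beta.AxialDressingRooted (coDressKBmAt coProjBmAt one_le_of_neZero)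
open Summit.QuantumFields.BalabanUV.Beta.BorderedHessian (KInvStep_zero_eq)
open Summit.QuantumFields.BalabanUV.Beta.D1BFx.GhostStencil (ghCur ghCur_apply)
open Summit.QuantumFields.BalabanUV.Beta.D1BFx.GhostLeg (Ggh)
open Summit.QuantumFields.BalabanUV.Beta.D1BFx.ReducedKernelF (vertexRedF TOfGh TOfLeg)
open Summit.QuantumFields.BalabanUV.Beta.D1BFx.PackedDressingBridge (sum_wsum_colH_coDressKBmAt)

/-! ## §1 Two small letters -/

/-- [our object] The ghost current is bounded by `2` entrywise. -/
theorem abs_ghCur_le_two (κ' : Fin 4) (u x z : Fin 4 → ℤ) (a b : Unit) : |ghCur κ' u x z a b| ≤ 2 := by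
  rw [ghCur_apply]
  split_ifs <;> norm_num

variable {Fb : Type*} {N : ℕ} [NeZero N]

/-- [folklore] `vertexRedF` is homogeneous in the stencil family. -/
theorem vertexRedF_const_smul (c : ℝ) (S : Fin 4 → (Fin 4 → ℤ) → MKer 4 Fb) (μ : Fin 4) (y : Fin 4 → ℤ) :
    vertexRedF N (fun κ u => c • S κ u) μ y = c • vertexRedF N S μ y := by
  funext x z a b
  simp only [vertexRedF, wsum, Pi.smul_apply, smul_eq_mul, Finset.mul_sum]
  refine Finset.sum_congr rfl fun κ _ => ?_
  rw [← tsum_mul_left]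
  exact tsum_congr fun u => by ring

/-! ## §2 `G₀`-packed scalar words are `wH`-packed words of the dressed family -/

section Road

variable {r : Fin 4 → ℕ} (hr : r ∈ box (3 + 1) N)
include hr

/-- [folklore] **THE ROAD's SCALAR-WEIGHTED WORD AT `G₀` IS THE END's `vertexRedF` OF THE Πᵀ_bm-DRESSED FAMILY**: for any entrywise-bounded family
`F : Fin 4 → ℤ⁴ → MKer 4 Fb`, `(x z a b ↦ Σ_κ wsum (colH G₀ N μ y κ) (F κ) x z a b) = vertexRedF N (Πᵀ_bm F) μ y`,
`(Πᵀ_bm F) κ u x z a b := coProjBmAt (toSite r) N (F · · x z a b) κ u` (PACK-BRIDGE §4 at `K := KInvStep N 0 = KInv`, whose `ℋ`-columns ARE `wH`). -/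
theorem sum_wsum_colH_G₀_eq_vertexRedF (F : Fin 4 → (Fin 4 → ℤ) → MKer 4 Fb) (hFb : ∀ x z a b, ∃ M : ℝ, ∀ κ u, |F κ u x z a b| ≤ M)
    (μ : Fin 4) (y : Fin 4 → ℤ) :
    (fun x z a b => ∑ κ : Fin 4, wsum (colH (coDressKBmAt (toSite r) N (KInvStep (d := 3) N 0)) N μ y κ) (F κ) x z a b)
      = vertexRedF N (fun κ u => fun x z a b => coProjBmAt (toSite r) N (fun κ' u' => F κ' u' x z a b) κ u) μ y := by
  funext x z a b
  obtain ⟨δ, C, hδ, -, hK⟩ := decays_KInvStep (d := 3) (Lc := N) 0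
  rw [sum_wsum_colH_coDressKBmAt (one_le_of_neZero N) hr hK hδ F x z a b (hFb x z a b) μ y]
  simp only [vertexRedF, KInvStep_zero_eq]
  refine Finset.sum_congr rfl fun κ _ => ?_
  have hw : colH (KInv (N := N)) N μ y κ = fun u => wH (N := N) (d := 3) κ μ (u - (N : ℤ) • y) :=
    funext fun u => (vertexOf_weight (N := N) κ μ u y).symm
  rw [hw]

/-- [folklore] **THE ROAD's GHOST MAIN WORD IS THE END's `TOfGh` AT THE DRESSED CURRENTS**: for any table family `W`, scalar `c` and leg parameter `a`,
`hessKer (Ggh N a) (κ′ v ↦ c • 𝒢[colH G₀ N κ′ v]) W μ ν z = TOfGh N a (κ u ↦ c • Πᵀ_bm ghCur κ u) W μ ν z`, `𝒢[w] := x y a b ↦ Σ_κ wsum (w κ) (ghCur κ) x y a b`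
(PART 7's ghost jets at `c := N²`). -/
theorem ghostWord_G₀_eq_TOfGh_coProj (a c : ℝ) (W : Fin 4 → (Fin 4 → ℤ) → Fin 4 → (Fin 4 → ℤ) → MKer 4 Unit) (μ ν : Fin 4) (z : Fin 4 → ℤ) :
    hessKer (Ggh N a)
        (fun κ' v => c • (fun x y a b => ∑ κ : Fin 4, wsum (colH (coDressKBmAt (toSite r) N (KInvStep (d := 3) N 0)) N κ' v κ) (ghCur κ) x y a b)) W μ ν z
      = TOfGh N a (fun κ u => c • (fun x z a b => coProjBmAt (toSite r) N (fun κ' u' => ghCur κ' u' x z a b) κ u)) W μ ν z := by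
  have h : (fun κ' v => c • (fun x y a b => ∑ κ : Fin 4, wsum (colH (coDressKBmAt (toSite r) N (KInvStep (d := 3) N 0)) N κ' v κ) (ghCur κ) x y a b))
      = vertexRedF N (fun κ u => c • (fun x z a b => coProjBmAt (toSite r) N (fun κ' u' => ghCur κ' u' x z a b) κ u)) := by
    funext κ' v
    rw [sum_wsum_colH_G₀_eq_vertexRedF hr ghCur (fun x z a b => ⟨2, fun κ u => abs_ghCur_le_two κ u x z a b⟩) κ' v, vertexRedF_const_smul]
  rw [h]
  rfl

end Road

end Summit.QuantumFields.BalabanUV.Beta.D1BFx.PackedGhostWordEnd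

end
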